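import Summits.QuantumFields.BalabanUV.Beta.SymCorrectorMixedSiteNull

/-!
# `BalabanUV.Beta.SymCorrectorMixedSiteWmix` — road «BF-x», binder row D1, slot (K) ∕ junction (J1), PART 24 HEAD row (ms): **TT21's IDENTITY RE-BRACKETED INTO leaf-01's `Wmix`
# ORIENTATION — `tadpole G (WMs μ y ν y′) = −½·tadpole G (Wmix(Θ′; V_M) μ y ν y′)`** (leaf-03 g33, OFFER O-2; files on a pricing seat's ∕ the OWNER's «WANTED»).

TT21 `SymCorrectorMixedSiteNull.tadpole_WMs_eq` prices the displayed mixed word of TT20 under the tadpole as `½·tadpole G (conjV (V_M ν y′) (Θ′ μ y) + conjV (V_M μ y) (Θ′ ν y′))`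
with `conjV V D = V∘D − D∘V` (`ChartConjugation.conjV`).  leaf-01 g32's bracket lemma `ColumnGaugePairContact.vertexFamily₂_Wmix_of_weight` (and the OWNER's (mcol) reduction via TT23
`tadpole_WMcol_eq_Wmix`) read the pair word in the orientation `Wmix(Λ; V) μ y ν y′ := (Λ ν y′∘V μ y − V μ y∘Λ ν y′) + (Λ μ y∘V ν y′ − V ν y′∘Λ μ y)`.  The two differ by a SIGN:
`conjV (V ν y′) (Θ′ μ y) + conjV (V μ y) (Θ′ ν y′) = −Wmix(Θ′; V) μ y ν y′` (§1, `abel`), so row (ms) meets the bracket lemma at `χ := ` the face symbol, `ξ := 1` after ONE rewrite (§2;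
lit `tadpole_smul` at `−1`).  At the record, row (ms)'s `V_H = vertexOfM G₀ n H` IS row (mcol)'s `vertexOfM K₀ n H` BY NAME — leaf-01 g31's `D1BFx/DressedMixVertexSplit.vertexOfM_coDress_eq`
(the multiplier vertex is not dressed), so one `VertexFamily` ∕ block-mass letter serves both rows.  [folklore] bookkeeping BY NAME; no definition, no `def … : Prop`, nothing cited, 0 sorry; prices NO (1.22) row.

HONEST DEPENDENCY (cell records, verbatim): «continuum YM on T⁴ ⇐ BetaPertH ∧ nine spine estimates (0/9 proved); BetaPertH ⇐ (D1) ∧ (D4) ∧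
CAP+tail; G-an2-4 gates asym, D1 and NE2/3/4.»  HONEST FRAMING (cell contract, verbatim): «discharging `BetaPertH` makes Bałaban's UV stability
UNCONDITIONAL — a real constructive-QFT result; it is NOT the continuum limit and NOT the Clay problem.»  0∕4 row-D1 binders; (J1) ONE OPEN ROW; (K) NOT closed; NOT D1,
NEVER «G-an2-4 closed», NOT `BetaPertH`, NOT continuum, NOT Clay.

ABSOLUTE RULE (cell charter, verbatim): «No internally-minted statement may enter as a cited fact. Every hypothesis is either kernel-proved in
this package or a verbatim quotation of a PUBLISHED theorem with page reference. The manuscript(s) under audit are NOT citable for their own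
disputed steps — they are the thing under adjudication; programme-internal (2001/route/tribunal) claims are never citable.»

Unit `b2b-balaban-beta-d1-formalise-leaf-03` (gen 33), 2026-08-23.  No existing file touched.
-/

noncomputable section

namespace Summit.QuantumFields.BalabanUV.Beta.SymCorrectorMixedSiteWmix

open Finset
open scoped BigOperators
open Literature.MathematicalPhysics.QuantumFieldTheory
open Literature.MathematicalPhysics.QuantumFieldTheory.Balaban1983to89
open Literature.MathematicalPhysics.QuantumFieldTheory.Balaban1983to89.Beta
open ExpKernelCalculus (MKer VertexFamily comp tadpole)
open KernelReflection (tadpole_smul)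
open OneStepResolventKernel (Fib)
open OneStepKernelFamily (colH)
open SecondOrderResponse (vertexOfM mixOfK)
open AffineAveraging (Site)
open AveragingContours (blk)
open Summit.QuantumFields.BalabanUV.Beta.TameKernelCalculus (Spr trK)
open Summit.QuantumFields.BalabanUV.Beta.BorderedHessian (sgnK diagK)
open Summit.QuantumFields.BalabanUV.Beta.ChartConjugation (conjV)
open Summit.QuantumFields.BalabanUV.Beta.AveragingWardRootedStencils (legSite)
open Summit.QuantumFields.BalabanUV.Beta.CompositeCorrectorLocality (blockSitesF)
open Summit.QuantumFields.BalabanUV.Beta.SymCorrectorFace (faceWt)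
open Summit.QuantumFields.BalabanUV.Beta.SymCorrectorMixedSiteNull (tadpole_WMs_eq)

variable {d : ℕ}

/-! ## §1 The two half commutators are minus the `Wmix` bracket -/

/-- [folklore] **`conjV (V₂) (D₁) + conjV (V₁) (D₂) = −((D₂∘V₁ − V₁∘D₂) + (D₁∘V₂ − V₂∘D₁))`** — TT21's half-commutator pair (`conjV V D = V∘D − D∘V`) is minus leaf-01's
`Wmix(D; V)` bracket (`(Λ ν y′∘V μ y − V μ y∘Λ ν y′) + (Λ μ y∘V ν y′ − V ν y′∘Λ μ y)` at `V₁ := V μ y`, `V₂ := V ν y′`, `D₁ := Λ μ y`, `D₂ := Λ ν y′`). -/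
theorem conjV_add_conjV_eq_neg_bracket {D : ℕ} {F : Type*} [Fintype F] (V₁ V₂ D₁ D₂ : MKer D F) :
    conjV V₂ D₁ + conjV V₁ D₂ = -((comp D₂ V₁ - comp V₁ D₂) + (comp D₁ V₂ - comp V₂ D₁)) := by
  unfold conjV
  abel

/-! ## §2 Row (ms) under the tadpole in the `Wmix` orientation -/

section Word

variable {n : ℕ} [NeZero n] (hn : 0 < n) {G : MKer (d + 1) (Fib d)} (hG : Spr G) (hGt : trK G = sgnK G) {K : MKer (d + 1) (Fib d)} (hK : Spr K)
  {M : Fin (d + 1) → Site (d + 1) → MKer (d + 1) (Fib d)} {CM δM : ℝ} (hMv : VertexFamily M n CM δM) (hδM : 0 < δM)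
  (hMp : ∀ ρ w, trK (M ρ w) = -sgnK (M ρ w)) (ϱ : Site (d + 1)) (r : Fin (d + 1) → ℕ) (ξ' : ℝ)
include hn hG hGt hK hMv hδM hMp

/-- [folklore] **`tadpole G (WMs μ y ν y′) = −½·tadpole G (Wmix(Θ′; V_M) μ y ν y′)`** — TT21 `tadpole_WMs_eq` with its half-commutator pair rewritten as minus leaf-01's bracket
(§1) and the sign taken out of the tadpole (lit `tadpole_smul` at `−1`).  Same hypotheses as TT21 (spread sgn-symmetric `G`, spread weight kernel `K`, coarse-localised row-parity-odd
multiplier table `M`, leg root `ϱ`, face-weight root `r`, scalar `ξ′`); `Θ′ μ y = diagK (z b ↦ Σ_α Σ_{x ∈ blockSitesF n (blk n (legSite ϱ z b))} colH K n μ y α x·(ξ′·faceWt r n α x))`,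
`V_M = vertexOfM K n M`. -/
theorem tadpole_WMs_eq_neg_Wmix (μ : Fin (d + 1)) (y : Site (d + 1)) (ν : Fin (d + 1)) (y' : Site (d + 1)) :
    tadpole G
        ((mixOfK K n (fun κ u ρ w => (if blk n ((n : ℤ) • w + ϱ) = blk n u then ξ' * faceWt r n κ u else 0) • M ρ w) μ y ν y'
            + mixOfK K n (fun κ u ρ w => (if blk n ((n : ℤ) • w + ϱ) = blk n u then ξ' * faceWt r n κ u else 0) • M ρ w) ν y' μ y)
          - (comp (diagK fun z b => ∑ α : Fin (d + 1), ∑ x ∈ blockSitesF n (blk n (legSite ϱ z b)), colH K n μ y α x * (ξ' * faceWt r n α x)) (vertexOfM K n M ν y')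
            + comp (diagK fun z b => ∑ α : Fin (d + 1), ∑ x ∈ blockSitesF n (blk n (legSite ϱ z b)), colH K n ν y' α x * (ξ' * faceWt r n α x)) (vertexOfM K n M μ y)))
      = -(1 / 2 : ℝ) * tadpole G
          ((comp (diagK fun z b => ∑ α : Fin (d + 1), ∑ x ∈ blockSitesF n (blk n (legSite ϱ z b)), colH K n ν y' α x * (ξ' * faceWt r n α x)) (vertexOfM K n M μ y)
              - comp (vertexOfM K n M μ y) (diagK fun z b => ∑ α : Fin (d + 1), ∑ x ∈ blockSitesF n (blk n (legSite ϱ z b)), colH K n ν y' α x * (ξ' * faceWt r n α x)))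
            + (comp (diagK fun z b => ∑ α : Fin (d + 1), ∑ x ∈ blockSitesF n (blk n (legSite ϱ z b)), colH K n μ y α x * (ξ' * faceWt r n α x)) (vertexOfM K n M ν y')
              - comp (vertexOfM K n M ν y') (diagK fun z b => ∑ α : Fin (d + 1), ∑ x ∈ blockSitesF n (blk n (legSite ϱ z b)), colH K n μ y α x * (ξ' * faceWt r n α x)))) := by
  rw [tadpole_WMs_eq hn hG hGt hK hMv hδM hMp ϱ r ξ' μ y ν y', conjV_add_conjV_eq_neg_bracket, ← neg_one_smul ℝ, tadpole_smul]
  ring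

end Word

end Summit.QuantumFields.BalabanUV.Beta.SymCorrectorMixedSiteWmix

end
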